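import Summits.QuantumFields.YangMills.Theorems.UnitScaleTiltProp7FibreELOfCritSplit
import HarnessLib

/-!
# Route `UnitScaleTilt`, crux K1 child «MinimiserStabilityRegPr» (stmt-QuantumFields-19200), skeleton v10, stub `stub_existenceMinimalOrbit` (EX), route (α) — **CONJUNCT (iii) OF `hXtw‴`
# WITH THE SLICE SPLIT DISPLAYED IN `HasFDerivAt` CURRENCY** (★★OWNER RULING g27-№5 (3), 2026-08-28: «no `fderiv`∕`deriv` junk values in a DISPLAYED row a supplier must inhabit» — the
# split row quantifies over ANY Fréchet derivative `D` of the (47)-map at the chart coordinate instead of naming `fderiv ℂ χ A′`; addendum to ✓`Prop7FibreELOfCritSplit`).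

Cell `ym3-torus`, width seat `ym-ust-19200-w2` (gen 5; EX knit lineage).  THEOREMS ONLY (0 `def`, 0 `sorry`).  `--supports stmt-QuantumFields-19200 --as helper`, count-neutral.
YM₃ on T³ is a ladder rung (R3), not the Clay problem; nothing here claims the stub, the crux, d = 4 or the mass gap.

WHAT IS PROVED (sorry-free, no definition; ns `…Theorems.Prop7FibreELOfCritSplitD`; `χ(A″) = A″ − H·Dfix(CmapTwS U₀) H C₂ˢ A″`).
★★★ `fibreEL_of_crit_splitD` — ✓`Prop7FibreELOfCritSplit.fibreEL_of_crit_split` with `hSplit` re-lettered: «for every continuous linear `D` with `HasFDerivAt χ D A′`, every `𝔰𝔲(2)`-valued `ξ` with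
`QSym(U′)ξ = 0` is `g(ad(−χ(A′)))(Dδ) + (iN(b₋) − U′(b)·iN(b₊)·U′(b)^*)` with `δ` real, `Sl δ`, `N` Hermitian-traceless» — junk-free for its supplier (who receives `HasFDerivAt χ D A′` as a hypothesis).
The consumer instantiates `D := fderiv ℂ χ A′` through (D47) ✓`hasFDerivAt_chartTwS_of_lt` (the half-ball window `2‖A′‖ < ε` is already a hypothesis of the assembly).  The ray row `hCrit`
keeps its `deriv … 0 = 0` letter: the consumer proves the differentiability of the ray functional itself (T1 along the clamped ray, ✓`lin_eq_zero_of_crit_ray`), so `deriv` is never read at a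
junk value — and «`deriv f 0 = 0`» is equivalent to «every derivative of `f` at `0` vanishes», which is what [Balaban1985Variational] (93) supplies.
HONEST SCOPE: re-lettering only; (93) and the split remain HYPOTHESES with the suppliers named in ✓`Prop7FibreELOfCritSplit`; nothing of print is asserted.

References: T. Bałaban, CMP 102 (1985) 277–309 [Balaban1985Variational] ((47)–(51) pp.285–286, (82)–(83) p.290, (93) p.291, Prop. 2 p.281, Prop. 5 p.294); CMP 99 (1985) 75–102
[Balaban1985RegularSpaces] (Sect. D pp.89–95, Prop. 7 p.98); CMP 98 (1985) 17–51 [Balaban1985Averaging] (Prop. 4 p.31, (32)–(34) pp.22–23).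
-/

set_option autoImplicit false

noncomputable section

open scoped BigOperators Matrix.Norms.L2Operator Matrix Topology

namespace Summit.QuantumFields.YangMills.Theorems.Prop7FibreELOfCritSplitD

open NormedSpace
open Literature.Analysis.Calculus.ExpDifferential (ad gSer)
open Literature.MathematicalPhysics.QuantumFieldTheory.Balaban1983to89
open Literature.MathematicalPhysics.QuantumFieldTheory.Balaban1983to89.T3ContinuumYM3Torus
open Literature.MathematicalPhysics.QuantumFieldTheory.Balaban1983to89.T3UnitLawDensityEML (ℰp)
open Literature.MathematicalPhysics.QuantumFieldTheory.Balaban1983to89.T3ConstrainedMinimiser (fibre)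
open Literature.MathematicalPhysics.QuantumFieldTheory.Balaban1983to89.T3PrintedRegularMinimiser (RegPr)
open Literature.MathematicalPhysics.QuantumFieldTheory.Balaban1983to89.T3SectALandauChart (emb15 eta)
open B11Prop3Model (Dfix)
open Summit.QuantumFields.YangMills.Theorems.Prop7TPrint (nMax19 expHermField)
open Summit.QuantumFields.YangMills.Theorems.Prop7SPrint (NormS)
open Summit.QuantumFields.YangMills.Theorems.Prop7SymAvgTwSym (CmapTwS)
open Summit.QuantumFields.YangMills.Theorems.Prop7SymAvgGL (QSym)
open Summit.QuantumFields.YangMills.Theorems.Prop7FibreELOfCritSplit (fibreEL_of_crit_split hasFDerivAt_chartTwS_of_lt)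

variable (F : T3Family) {n K : ℕ} (h : n ≤ K) [Fact (0 < (F.L : ℝ))] [Fact (0 < ((F.L : ℝ)⁻¹) ^ (K - n))]

/-- ★★★ **CONJUNCT (iii) OF `hXtw‴` FROM (93) (RAY FORM) AND THE SLICE SPLIT IN `HasFDerivAt` CURRENCY.**  As ✓`Prop7FibreELOfCritSplit.fibreEL_of_crit_split` (same data, same windows,
same conclusion VERBATIM) with `hSplit` quantified over every continuous linear `D` such that `HasFDerivAt χ D A′` (★★OWNER RULING g27-№5 (3): no `fderiv` in a displayed row); the
consumer reads it at `D := fderiv ℂ χ A′` by (D47) ✓`hasFDerivAt_chartTwS_of_lt`.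
[cite: Balaban1985Variational, (93) p.291, (82)-(83) p.290, (47)-(51) pp.285-286, Prop. 2 p.281, Prop. 5 p.294; Balaban1985RegularSpaces, Sect. D pp.89-95, Prop. 7 p.98; Balaban1985Averaging, Prop. 4 p.31] -/
theorem fibreEL_of_crit_splitD {ε₀ e b ε : ℝ} (hε₀ : 0 < ε₀) (he : 0 < e) (hWe : 10 ^ 9 * (F.L : ℝ) ^ 2 * e ≤ 1) (hWε : 10 ^ 12 * (F.L : ℝ) ^ 3 * ε₀ ≤ 1)
    (hw137 : 10 ^ 7 * (F.L : ℝ) ^ 3 * (178 * (ε₀ + e)) ≤ 1)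
    (U₀ : GaugeField (F.P K) 0 (Matrix.specialUnitaryGroup (Fin 2) ℂ)) (hreg : RegPr F n K ε₀ U₀)
    {H : (PBond (F.P n) 0 → Matrix (Fin 2) (Fin 2) ℂ) →ₗ[ℂ] (PBond (F.P K) 0 → Matrix (Fin 2) (Fin 2) ℂ)} (hb : 0 ≤ b) (hHop : ∀ Y, ‖H Y‖ ≤ b * ‖Y‖)
    (hHR : ∀ Y : PBond (F.P n) 0 → Matrix (Fin 2) (Fin 2) ℂ, (∀ c, star (Y c) = -Y c ∧ (Y c).trace = 0) → ∀ b', star (H Y b') = -H Y b' ∧ (H Y b').trace = 0)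
    (hq : 9 * (40 * (2 * (3 * (2 * e + 2700 * (F.L : ℝ) * ε₀))) / (e * eta F n K) ^ 2) * b * ε < 1) (hRε : 6 * ε ≤ e * eta F n K)
    {A' : PBond (F.P K) 0 → Matrix (Fin 2) (Fin 2) ℂ} (hA'ε : 2 * ‖A'‖ < ε) (hA'R : ∀ b', star (A' b') = -A' b' ∧ (A' b').trace = 0)
    {X : PBond (F.P K) 0 → Matrix (Fin 2) (Fin 2) ℂ} (hX : ∀ b, (X b).IsHermitian ∧ (X b).trace = 0)
    (hAX : A' - H (Dfix (CmapTwS F n K h U₀) H (40 * (2 * (3 * (2 * e + 2700 * (F.L : ℝ) * ε₀))) / (e * eta F n K) ^ 2) A') = fun b' => Complex.I • X b')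
    (hsize : nMax19 F n K U₀ X < e)
    (Sl : (PBond (F.P K) 0 → Matrix (Fin 2) (Fin 2) ℂ) → Prop)
    (hCrit : ∀ δ : PBond (F.P K) 0 → Matrix (Fin 2) (Fin 2) ℂ, (∀ b', star (δ b') = -δ b' ∧ (δ b').trace = 0) → Sl δ →
      deriv (fun t : ℝ => wilsonAction4 (emb15 U₀ (expHermField (fun b' : PBond (F.P K) 0 => (-Complex.I) •
        ((A' + (t : ℂ) • δ) - H (Dfix (CmapTwS F n K h U₀) H (40 * (2 * (3 * (2 * e + 2700 * (F.L : ℝ) * ε₀))) / (e * eta F n K) ^ 2) (A' + (t : ℂ) • δ))) b')))) 0 = 0)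
    (hSplitD : ∀ D : (PBond (F.P K) 0 → Matrix (Fin 2) (Fin 2) ℂ) →L[ℂ] (PBond (F.P K) 0 → Matrix (Fin 2) (Fin 2) ℂ),
      HasFDerivAt (fun A : PBond (F.P K) 0 → Matrix (Fin 2) (Fin 2) ℂ =>
        A - H (Dfix (CmapTwS F n K h U₀) H (40 * (2 * (3 * (2 * e + 2700 * (F.L : ℝ) * ε₀))) / (e * eta F n K) ^ 2) A)) D A' →
      ∀ ξ : PBond (F.P K) 0 → Matrix (Fin 2) (Fin 2) ℂ, (∀ b', star (ξ b') = -ξ b' ∧ (ξ b').trace = 0) →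
      QSym F n K h (emb15 U₀ (expHermField X)) ξ = 0 →
      ∃ δ : PBond (F.P K) 0 → Matrix (Fin 2) (Fin 2) ℂ, (∀ b', star (δ b') = -δ b' ∧ (δ b').trace = 0) ∧ Sl δ ∧
        ∃ N : Site (F.P K) 0 → Matrix (Fin 2) (Fin 2) ℂ, (∀ x, (N x).IsHermitian ∧ (N x).trace = 0) ∧
          ∀ b' : PBond (F.P K) 0, ξ b' =
            gSer ℂ (ad ℂ (-(A' - H (Dfix (CmapTwS F n K h U₀) H (40 * (2 * (3 * (2 * e + 2700 * (F.L : ℝ) * ε₀))) / (e * eta F n K) ^ 2) A')) b'))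
              ((D δ) b')
            + (Complex.I • N b'.src - ((emb15 U₀ (expHermField X) b' : Matrix.specialUnitaryGroup (Fin 2) ℂ) : Matrix (Fin 2) (Fin 2) ℂ) * (Complex.I • N b'.tgt)
                * star ((emb15 U₀ (expHermField X) b' : Matrix.specialUnitaryGroup (Fin 2) ℂ) : Matrix (Fin 2) (Fin 2) ℂ)))
    (V : GaugeField (F.P n) 0 (Matrix.specialUnitaryGroup (Fin 2) ℂ)) :
    ∀ u : GaugeTransf (F.P K) 0 (Matrix.specialUnitaryGroup (Fin 2) ℂ), NormS F n K h U₀ X (expHermField X) u →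
      GaugeField.gaugeAct u (emb15 U₀ (expHermField X)) ∈ fibre F ℰp n K h V →
      ∀ γ : ℝ → GaugeField (F.P K) 0 (Matrix.specialUnitaryGroup (Fin 2) ℂ), γ 0 = GaugeField.gaugeAct u (emb15 U₀ (expHermField X)) →
        (∀ t, γ t ∈ fibre F ℰp n K h V) →
        (∀ b, DifferentiableAt ℝ (fun t => ((γ t b : Matrix.specialUnitaryGroup (Fin 2) ℂ) : Matrix (Fin 2) (Fin 2) ℂ)) 0) →
          deriv (fun t => wilsonAction4 (γ t)) 0 = 0 :=
  fibreEL_of_crit_split F h hε₀ he hWe hWε hw137 U₀ hreg hb hHop hHR hq hRε hA'ε hA'R hX hAX hsize Sl hCrit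
    (hSplitD _ (hasFDerivAt_chartTwS_of_lt F h hε₀ he hWe hWε U₀ hreg hb hHop hq hRε hA'ε)) V

end Summit.QuantumFields.YangMills.Theorems.Prop7FibreELOfCritSplitD

end
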